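import Literature.Computability.Cryptography.PeikertPerturbation
import HarnessLib

/-!
# Peikert's first component with `√(log n)`-free parameters: NO case, norm tail and hiding for a machine-chosen width

Topic `Computability/Cryptography` (family `pqc`), sequel of `PeikertReduction.lean` and
`PeikertPerturbation.lean` (the analysis of the first component `h₁` of
`peikert_gapSVPZeta_to_lwe_classical_of_components`, named fact
`Literature.Computability.Cryptography.peikert_gapSVPZeta_to_lwe_classical`, pqc.S20: NO case
`Peikert2009.no_case_scaled` with Peikert's radius `d'(D) = D√n/(2√(log n))`, the rounded-Gaussian
norm tail `roundedGaussian_perturbRadius_lt_norm_le` at the width `σ(D) = D/(8√(log n))`, and the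
hiding bound `prob_names_perturbation_roundedGaussian_le` / `inv_poly_le_hiding_advantage`).
Everything here is PROVED (theorems, one constant with body); no named fact.

Why. The MACHINE of `h₁` (built from the tree's bricks `exists_polyTime_ttRandSubroutine`, the
coin-driven sampler `PGParams.samplerFlat` / `PseudoGaussianSamplerTV.lean` and Babai's residual
`Babai.residual`) must COMPUTE its parameters exactly: the rational `r ∈ [r₀, 2r₀]`,
`r₀ = q√(2n)/(γ·Md)`, and the sampler's mesh exponent `b` with width `σ₀ = 2ᵇ/√2`. Peikert's factor
`√(log n)` in `γ ≥ n/(α√(log n))`, in `d' = d√(n/(4 log n))` and hence in `σ(D)` is there to make the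
approximation factor as small as `O(n/(α√(log n)))`; pqc.S20 only asks `γ = Õ(n/α)`, and with the
choice `γ = 2n/α` every `√(log n)` disappears: the radius becomes `D√n/2`, the width any
`σ₀ ∈ (D/16, D/8]` (a window of ratio `2`, which the machine hits exactly by the test `4ᵇ ≤ 2(D/8)²`),
`r₀ = qα√(2n)/(2n·M·d)` is rational up to `√(2n)` (and `q⌈√(2n)⌉α/(2nMd) ∈ [r₀, 2r₀]`), and the hiding
advantage becomes an ABSOLUTE CONSTANT (`hidingAdvantage = e^{-81/2}/(2√(2π))`, from
`D/(2σ₀) ≤ 8`), so that a constant number of iterations suffices. This file derives that regime from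
the landed theorems by INSTANTIATION (no analysis is redone):

* `Peikert2009.no_case_scaled_unit` — **the NO case with `γ ≥ 2n/α` and perturbations of norm
  `≤ D√n/2`**: `no_case_scaled` at the parameters `(γ', D') = (γ/√(log n), D√(log n))`, for which
  `γ'D' = γD`, `d'(D') = D√n/2`, `Mζ/γ' ≥ D'` and `q√(2n)/(γ'D') = q√(2n)/(γD)` (dimension `n ≥ 3`,
  so that `√(log n) ≥ 1`).
* `Peikert2009.roundedGaussian_norm_tail_le` — **norm tail for any width `σ ≥ ½`**: the rounded
  Gaussian `roundedGaussian n σ` exceeds any radius `ρ ≥ 4σ√n` with probability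
  `≤ 2^{n/2}e^{-2n}` (`roundedGaussian_perturbRadius_lt_norm_le` at `D'' = 8σ√(log n)`, where
  `σ(D'') = σ`, `d'(D'') = 4σ√n`); in particular radius `D√n/2` for `σ ≤ D/8`.
* `Peikert2009.hidingAdvantage = (√(2π))⁻¹ e^{-81/2}/2 > 0` and `hidingAdvantage_le` — for
  `0 ≤ D ≤ 16σ`: `hidingAdvantage ≤ (√(2π))⁻¹ e^{-(D/(2σ)+1)²/2}/2`, whence
  **`prob_names_perturbation_roundedGaussian_le_unit`**: a solver whose view is invariant under a
  nonzero lattice shift of norm `≤ D` names a `roundedGaussian n σ` perturbation (`D ≤ 16σ`) with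
  probability `≤ 1 - hidingAdvantage`.

## References

* C. Peikert, *Public-key cryptosystems from the worst-case shortest vector problem*, STOC 2009, proof
  of Thm. 3.1 (full version, Dagstuhl Seminar Proc. 08491, p. 12) [Peikert2009].
* O. Goldreich, S. Goldwasser, *On the limits of nonapproximability of lattice problems*,
  J. Comput. Syst. Sci. 60 (2000), §3 (the ball-overlap hiding argument) [GoldreichGoldwasser2000].
-/

noncomputable section

open Filter Metric Literature.Computability.Complexity Literature.Algebra.EuclideanLattices
  Literature.Computability.Cryptography
open scoped ENNReal

namespace Literature.Computability.Cryptography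

namespace Peikert2009

/-! ### `√(log n) ≥ 1` from dimension `3` on -/

/-- `1 ≤ log n` for `n ≥ 3` (`e < 3`); private copy of a lemma also proved in an unrelated barrier file
(`Literature.Barriers.Schanuel.one_le_log_of_three_le_nat`), kept local to avoid the import. [folklore] -/
private theorem one_le_log {n : ℕ} (hn : 3 ≤ n) : 1 ≤ Real.log n := by
  have h3 : (3 : ℝ) ≤ n := by exact_mod_cast hn
  rw [Real.le_log_iff_exp_le (by linarith)]
  have := Real.exp_one_lt_d9
  linarith

/-- `1 ≤ √(log n)` for `n ≥ 3`. [folklore] -/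
theorem one_le_sqrt_log {n : ℕ} (hn : 3 ≤ n) : 1 ≤ Real.sqrt (Real.log n) := by
  rw [show (1 : ℝ) = Real.sqrt 1 by simp]
  exact Real.sqrt_le_sqrt (one_le_log hn)

/-! ### The NO case with `γ ≥ 2n/α` and radius `D√n/2` -/

/-- **The NO case of Thm. 3.1 on a scaled instance, `√(log n)`-free form.** Let `J` be a nonsingular
integer instance of dimension `n ≥ 3` with Gram–Schmidt norms `≥ M`, minimum distance `> γD`, where
`1 ≤ M ≤ D ≤ Mζ/γ` (the `M`-fold copy of a NO instance `(B, d)` of `GapSVP_{ζ,γ}`, `D = Md`), in the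
regime `α ∈ (0,1)`, **`γ ≥ 2n/α`**, `q ≥ ζf√(log n)/√n` (`f ≥ 0`, `q ≥ 1`). Then for every perturbation
`w ∈ ℤⁿ` with **`‖w‖ ≤ D√n/2`**, every target `x ≡ w (mod L(J))` and every rational `r ∈ [r₀, 2r₀]`,
`r₀ = q√(2n)/(γD)`, the call `((J, x), r)` is `f`-admissible and its only admissible answer is `x - w`.
(This is `no_case_scaled` at `(γ', D') = (γ/√(log n), D√(log n))`: `γ'D' = γD`, Peikert's radius
`d'(D') = D'√n/(2√(log n)) = D√n/2`, `γ' ≥ 2n/(α√(log n))`, and `r₀` is unchanged.)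
[cite: Peikert2009, Thm. 3.1 proof (NO case, full version p. 12)] -/
theorem no_case_scaled_unit {q : ℕ → ℕ} {α f ζ γ : ℕ → ℝ} (J : LatticeInstance) (hJ : J.IsNonsingular)
    {M D : ℝ} (hM : 1 ≤ M) (hMD : M ≤ D) (hGS : ∀ i, M ≤ ‖InnerProductSpace.gramSchmidt ℝ J.vec i‖)
    (hno : γ J.n * D < minNorm J.lattice) (hDζ : D ≤ M * ζ J.n / γ J.n)
    (hn : 3 ≤ J.n) (hα : 0 < α J.n) (hα1 : α J.n < 1) (hf : 0 ≤ f J.n) (hq1 : 1 ≤ q J.n)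
    (hγ : 2 * J.n / α J.n ≤ γ J.n)
    (hq : ζ J.n * f J.n * Real.sqrt (Real.log J.n) / Real.sqrt J.n ≤ q J.n)
    (x w : Fin J.n → ℤ) (hxw : intVecToEuclidean J.n x - intVecToEuclidean J.n w ∈ J.lattice)
    (hw : ‖intVecToEuclidean J.n w‖ ≤ D * Real.sqrt J.n / 2) (r : ℚ)
    (hr : q J.n * Real.sqrt (2 * J.n) / (γ J.n * D) ≤ r)
    (hr2 : (r : ℝ) ≤ 2 * (q J.n * Real.sqrt (2 * J.n) / (γ J.n * D))) :
    BDDAdmissible q α f (⟨J, x⟩, r) ∧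
      ∀ v, CVP.IsSolution (fun _ => 1) ⟨J, x⟩ v → v = x - w := by
  set L := Real.sqrt (Real.log J.n) with hLdef
  have hL1 : 1 ≤ L := one_le_sqrt_log hn
  have hLpos : 0 < L := lt_of_lt_of_le one_pos hL1
  have hn2 : (2 : ℝ) ≤ J.n := by exact_mod_cast (le_trans (by norm_num) hn)
  have hMpos : 0 < M := lt_of_lt_of_le one_pos hM
  have hDpos : 0 < D := lt_of_lt_of_le hMpos hMD
  have hγ0 : 0 < 2 * (J.n : ℝ) / α J.n := div_pos (by linarith) hα
  have hγpos : 0 < γ J.n := lt_of_lt_of_le hγ0 hγ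
  -- the auxiliary parameters `γ' = γ/L`, `D' = D L`
  set γ' : ℕ → ℝ := fun k => γ k / Real.sqrt (Real.log k) with hγ'def
  have hγ'n : γ' J.n = γ J.n / L := rfl
  have hprod : γ' J.n * (D * L) = γ J.n * D := by
    rw [hγ'n]; field_simp
  have h := no_case_scaled (q := q) (α := α) (f := f) (ζ := ζ) (γ := γ') J hJ (M := M) (D := D * L) hM
    (hMD.trans (le_mul_of_one_le_right hDpos.le hL1)) hGS (by rw [hprod]; exact hno)
    (by
      rw [hγ'n, le_div_iff₀ (div_pos hγpos hLpos)]
      have := (le_div_iff₀ hγpos).1 hDζ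
      calc D * L * (γ J.n / L) = D * γ J.n := by field_simp
        _ ≤ M * ζ J.n := by linarith [mul_comm D (γ J.n)])
    (le_trans (by norm_num) hn) hα hα1 hf hq1
    (by
      rw [hγ'n, le_div_iff₀ hLpos]
      calc 2 * (J.n : ℝ) / (α J.n * L) * L = 2 * J.n / α J.n := by field_simp
        _ ≤ γ J.n := hγ)
    hq x w hxw
    (by
      show ‖intVecToEuclidean J.n w‖ ≤ perturbRadius J.n (D * L)
      rw [perturbRadius, ← hLdef]
      calc ‖intVecToEuclidean J.n w‖ ≤ D * Real.sqrt J.n / 2 := hw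
        _ = D * L * Real.sqrt J.n / (2 * L) := by field_simp)
    r (by rw [hprod]; exact hr) (by rw [hprod]; exact hr2)
  exact h

/-! ### The norm tail for any width `σ ≥ ½` -/

/-- **Norm tail of the rounded Gaussian, width-uniform form**: for `n ≥ 2`, any width `σ ≥ ½` and any
radius `ρ ≥ 4σ√n`, `Pr_{w ∼ roundedGaussian n σ}[‖w‖ > ρ] ≤ 2^{n/2}e^{-2n}`. This is
`roundedGaussian_perturbRadius_lt_norm_le` at `D'' = 8σ√(log n)` (for which Peikert's width
`σ(D'') = D''/(8√(log n))` is `σ` and the radius `d'(D'') = 4σ√n`; its hypothesis `4√(log n) ≤ D''` is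
`σ ≥ ½`), followed by monotonicity in the radius. For the machine's width `σ ∈ (D/16, D/8]` and radius
`D√n/2 ≥ 4σ√n` this is the NO-case event "the perturbation is too long".
[cite: Peikert2009, Thm. 3.1 proof (NO case, full version p. 12)] -/
theorem roundedGaussian_norm_tail_le {n : ℕ} (hn : 2 ≤ n) {σ : ℝ} (hσ : 1 / 2 ≤ σ) {ρ : ℝ}
    (hρ : 4 * σ * Real.sqrt n ≤ ρ) :
    ((Literature.Probability.Distributions.roundedGaussian n σ).toOuterMeasure
        {w | ρ < ‖intVecToEuclidean n w‖}).toReal ≤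
      (2 : ℝ) ^ ((n : ℝ) / 2) * Real.exp (-(2 * n)) := by
  set L := Real.sqrt (Real.log n) with hLdef
  have hLpos : 0 < L := lt_trans (by norm_num) (half_lt_sqrt_log hn)
  set D'' : ℝ := 8 * σ * L with hD''
  have hwidth : perturbWidth n D'' = σ := by
    rw [perturbWidth, hD'', ← hLdef]; field_simp
  have hrad : perturbRadius n D'' = 4 * σ * Real.sqrt n := by
    rw [perturbRadius, hD'', ← hLdef]; field_simp; ring
  have hD : 4 * Real.sqrt (Real.log n) ≤ D'' := by
    rw [hD'', ← hLdef]; nlinarith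
  have h := roundedGaussian_perturbRadius_lt_norm_le hn hD
  rw [hwidth, hrad] at h
  refine le_trans (ENNReal.toReal_mono (toOuterMeasure_ne_top _ _) (PMF.toOuterMeasure_mono _ ?_)) h
  intro w hw
  exact lt_of_le_of_lt hρ hw.1

/-! ### The hiding advantage is an absolute constant -/

/-- **The hiding advantage at `D/(2σ) ≤ 8`**: `(√(2π))⁻¹ e^{-81/2}/2`. [cite: Peikert2009, Thm. 3.1 proof (YES case, full version p. 12)] -/
def hidingAdvantage : ℝ := (Real.sqrt (2 * Real.pi))⁻¹ * Real.exp (-(81 / 2)) / 2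

/-- `hidingAdvantage > 0`. [folklore] -/
theorem hidingAdvantage_pos : 0 < hidingAdvantage := by
  unfold hidingAdvantage; positivity

/-- `hidingAdvantage ≤ 1/2`. [folklore] -/
theorem hidingAdvantage_le_half : hidingAdvantage ≤ 1 / 2 := by
  unfold hidingAdvantage
  have h1 : (Real.sqrt (2 * Real.pi))⁻¹ ≤ 1 := by
    apply inv_le_one_of_one_le₀
    rw [show (1 : ℝ) = Real.sqrt 1 by simp]
    exact Real.sqrt_le_sqrt (by linarith [Real.pi_gt_three])
  have h2 : Real.exp (-(81 / 2 : ℝ)) ≤ 1 := Real.exp_le_one_iff.2 (by norm_num)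
  have h3 : 0 ≤ Real.exp (-(81 / 2 : ℝ)) := (Real.exp_pos _).le
  nlinarith [mul_le_mul h1 h2 h3 zero_le_one]

/-- **For `0 ≤ D ≤ 16σ` the hiding advantage of width `σ` against shifts of norm `≤ D` is at least
`hidingAdvantage`** (`D/(2σ) ≤ 8`, so `(D/(2σ) + 1)² ≤ 81`). [cite: Peikert2009, Thm. 3.1 proof (YES case, full version p. 12)] -/
theorem hidingAdvantage_le {D σ : ℝ} (hσ : 0 < σ) (hD : 0 ≤ D) (hDσ : D ≤ 16 * σ) :
    hidingAdvantage ≤ (Real.sqrt (2 * Real.pi))⁻¹ * Real.exp (-(D / (2 * σ) + 1) ^ 2 / 2) / 2 := by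
  unfold hidingAdvantage
  have hratio : D / (2 * σ) ≤ 8 := by rw [div_le_iff₀ (by positivity)]; linarith
  have h0 : 0 ≤ D / (2 * σ) := by positivity
  have hsq : (D / (2 * σ) + 1) ^ 2 / 2 ≤ 81 / 2 := by nlinarith
  have hexp : Real.exp (-(81 / 2)) ≤ Real.exp (-(D / (2 * σ) + 1) ^ 2 / 2) := Real.exp_le_exp.2 (by linarith)
  have hc : 0 ≤ (Real.sqrt (2 * Real.pi))⁻¹ := by positivity
  exact div_le_div_of_nonneg_right (mul_le_mul_of_nonneg_left hexp hc) (by norm_num)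

/-- **YES case, `√(log n)`-free form**: on a nonsingular integer instance `J` containing a nonzero
lattice vector `z` of norm `≤ D`, a solver whose view `red` is invariant under lattice shifts names a
`roundedGaussian J.n σ` perturbation, `D ≤ 16σ`, with probability `≤ 1 - hidingAdvantage` — an absolute
constant below `1`, whatever its coins (`prob_names_perturbation_roundedGaussian_le` with
`hidingAdvantage_le`). [cite: Peikert2009, Thm. 3.1 proof (YES case, full version p. 12)] -/
theorem prob_names_perturbation_roundedGaussian_le_unit {J : LatticeInstance} {C X β : Type*} (μ : PMF C)
    (red : (Fin J.n → ℤ) → X) (lift : X → (Fin J.n → ℤ)) (run : X → C → β) (dec : β → (Fin J.n → ℤ))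
    (hred : ∀ z w : Fin J.n → ℤ, intVecToEuclidean J.n z ∈ J.lattice → red (z + w) = red w)
    {D σ : ℝ} (hσ : 0 < σ) (hD : 0 ≤ D) (hDσ : D ≤ 16 * σ)
    (hz : ∃ z : Fin J.n → ℤ, z ≠ 0 ∧ intVecToEuclidean J.n z ∈ J.lattice ∧ ‖intVecToEuclidean J.n z‖ ≤ D) :
    ((μ.bind fun c => (Literature.Probability.Distributions.roundedGaussian J.n σ).map fun w => (c, w)).toOuterMeasure
        {p | dec (run (red p.2) p.1) = lift (red p.2) - p.2}).toReal ≤ 1 - hidingAdvantage := by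
  refine (prob_names_perturbation_roundedGaussian_le μ red lift run dec hred hσ hz).trans ?_
  linarith [hidingAdvantage_le hσ hD hDσ]

end Peikert2009

end Literature.Computability.Cryptography

end
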